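import Mathlib
import HarnessLib
import Summits.Ventures.LatticeQCDFlow.Exactness.JitteredHMC
import Summits.Ventures.LatticeQCDFlow.Exactness.SUNWilsonForceLaw

/-!
# The engine's OMF2 and OMF4 integrators on `SU(N)` with `tau_jitter`: the jittered 5- and 11-stage HMC updates are exact for every law of the trajectory length, every coefficient, every `nstep`

HONEST FRAMING: exact (Metropolis-corrected) sampling algorithms for lattice gauge theory;
figures of merit are autocorrelation/cost numbers at stated couplings and volumes; no
continuum-physics claim.

Venture `LatticeQCDFlow` (cell pub-lqcd), topic `Exactness`, FANOUT row 9 (eng-latcore, GEN-24; the engine's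
`latflow.core.hmc.HMC(f, β, 'omf2'|'omf4').trajectory(rng, τ, nstep, tau_jitter = j)`: length `τ' = τ(1 + j(2u − 1))`,
`u ∼ U(0,1)`, `ε = τ'/nstep`; OMF2 step `K(−λεF) D(ε/2) K(−(1−2λ)εF) D(ε/2) K(−λεF)`; OMF4 step (11 stages, P-first)
kicks `−(ϑε)F, −(λε)F, −((½−λ−ϑ)ε)F`, drifts `ρε, θε, (1−2(θ+ρ))ε`; flip; Metropolis).  NEW WORK of the cell over GEN-22's
`JitteredHMC.lean` (`jitterHMC`, `measurable_jitterMap`, `jitterHMC_exact`), `SplittingWords.lean` / `SplittingIntegrator.lean`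
(`omf2Word`, `omf4Word`, `palindromicWord`, `palindromicWord_pow_isFlipReversible`, `omf2/omf4_stages_isFlipReversible`,
`omf2/omf4_stages_measurePreserving`, `measurePreserving_palindromicWord`, `measurePreserving_perm_pow`), `SUNLeapfrogHMC.lean`,
`SUNWilsonForceLaw.lean`.  Nothing is cited as a fact; no number is claimed.  NAMED ONLY: Omelyan–Mryglod–Folk 2003.
Row 14's `Omf2ProposalLaws.lean` has the proposal-level facts at a fixed step; the UPDATE kernels for `SU(N)` — with a
label-dependent step, for ANY label law — were not typed ("OMF words / tau_jitter" in the typed-exactness map).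

* §1 **`measurable_uncurry_listProd`**, **`measurable_uncurry_palindromicWord`**, `measurable_uncurry_labelledPow` (labelled
  words / powers of labelled-measurable stages are jointly measurable — induction on the stage list);
  **`measurable_uncurry_sunOmf2ProposalN`**, **`measurable_uncurry_sunOmf4ProposalN`**.
* §2/§3 **`sunOmf2JitterHMCL`**, **`sunOmf4JitterHMCL`** (ANY measurable label space); Markov; **`…_invariant`**:
  `e^{−S}·Haar^{⊗links}` invariant for EVERY probability law `η` and all measurable coefficient / kick assignments.
* §4 THE ENGINE AS RUN: **`wilsonOmf2JitterHMCL N d L β lam nstep η`**, **`wilsonOmf4JitterHMCL N d L β rho theta vth lam nstep η`**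
  (label = the drawn length `τ' ∼ η`, any Borel law on `ℝ`); **`wilsonOmf2JitterHMCL_invariant`**, **`wilsonOmf4JitterHMCL_invariant`**
  — `wilsonMeasure (β/N)` invariant for EVERY coefficient choice, `nstep`, law of the length (`δ_τ` = no jitter; the code's
  `tau_jitter` = `UniformJitterLaw.lean`).

NOT CLAIMED: ergodicity of the OMF updates (the short-trajectory minorisation is typed for the leapfrog word only); the
integrators' error orders; floating point.
-/

noncomputable section

namespace Summit.Ventures.LatticeQCDFlow.Exactness

open MeasureTheory ProbabilityTheory ProbabilityTheory.Kernel Set Function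
open Literature.MathematicalPhysics.QuantumFieldTheory
open Literature.MathematicalPhysics.QuantumLattice (fundamentalRep continuous_fundamentalRep)
open scoped ENNReal Matrix NNReal

set_option backward.isDefEq.respectTransparency false

/-! ## §1 Labelled measurability: stages, words, powers -/

section Words
variable {Lab Z : Type*} [MeasurableSpace Lab] [MeasurableSpace Z]

/-- **A labelled list of labelled-measurable permutations has a jointly measurable product.** -/
theorem measurable_uncurry_listProd (Ls : List (Lab → Equiv.Perm Z))
    (h : ∀ A ∈ Ls, Measurable fun q : Lab × Z => A q.1 q.2) :
    Measurable fun q : Lab × Z => (Ls.map fun A => A q.1).prod q.2 := by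
  induction Ls with
  | nil => simpa using measurable_snd
  | cons A rest ih =>
      have hA := h A (List.mem_cons_self ..)
      have hr := ih fun B hB => h B (List.mem_cons_of_mem _ hB)
      have hfun : (fun q : Lab × Z => ((A :: rest).map fun B => B q.1).prod q.2) =
          fun q => A q.1 ((rest.map fun B => B q.1).prod q.2) := by
        funext q; simp [List.map_cons, List.prod_cons, Equiv.Perm.coe_mul]
      rw [hfun]
      exact hA.comp (measurable_fst.prodMk hr)

/-- **A labelled palindromic word of labelled-measurable stages is jointly measurable.** -/
theorem measurable_uncurry_palindromicWord (Ls : List (Lab → Equiv.Perm Z)) (X : Lab → Equiv.Perm Z)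
    (h : ∀ A ∈ Ls, Measurable fun q : Lab × Z => A q.1 q.2) (hX : Measurable fun q : Lab × Z => X q.1 q.2) :
    Measurable fun q : Lab × Z => palindromicWord (Ls.map fun A => A q.1) (X q.1) q.2 := by
  have h1 := measurable_uncurry_listProd Ls h
  have h2 : Measurable fun q : Lab × Z => ((Ls.map fun A => A q.1).reverse).prod q.2 := by
    have := measurable_uncurry_listProd Ls.reverse (fun A hA => h A (List.mem_reverse.1 hA))
    simpa [List.map_reverse] using this
  have hfun : (fun q : Lab × Z => palindromicWord (Ls.map fun A => A q.1) (X q.1) q.2) =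
      fun q => (Ls.map fun A => A q.1).prod (X q.1 (((Ls.map fun A => A q.1).reverse).prod q.2)) := by
    funext q; simp [palindromicWord, Equiv.Perm.coe_mul]
  rw [hfun]
  exact h1.comp (measurable_fst.prodMk (hX.comp (measurable_fst.prodMk h2)))

/-- A labelled power with a measurable label-dependent exponent, followed by a fixed measurable map, is jointly
measurable. -/
theorem measurable_uncurry_labelledPow {N : Lab → ℕ} {f : Lab → Z → Z}
    (hf : Measurable fun q : Lab × Z => f q.1 q.2) (hN : Measurable N) :
    Measurable fun q : Lab × Z => (f q.1)^[N q.1] q.2 := by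
  set W : Lab × Z → Lab × Z := fun q => (q.1, f q.1 q.2) with hW
  have hWm : Measurable W := measurable_fst.prodMk hf
  have hiter : ∀ (k : ℕ) (q : Lab × Z), W^[k] q = (q.1, (f q.1)^[k] q.2) := by
    intro k; induction k with
    | zero => intro q; rfl
    | succ k ih => intro q; rw [Function.iterate_succ_apply', ih, Function.iterate_succ_apply']
  have hF : Measurable fun r : (Lab × Z) × ℕ => (W^[r.2] r.1).2 :=
    measurable_from_prod_countable_left fun k => measurable_snd.comp (hWm.iterate k)
  have hcomp : (fun q : Lab × Z => (f q.1)^[N q.1] q.2) = fun q => (W^[N q.1] q).2 := by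
    funext q; rw [hiter]
  rw [hcomp]
  exact hF.comp (measurable_id.prodMk (hN.comp measurable_fst))
end Words

section Measurable
variable {n : Type*} [Fintype n] [DecidableEq n] {E : Type*} [NormedAddCommGroup E] [NormedSpace ℝ E]
  [MeasurableSpace E] [BorelSpace E] [FiniteDimensional ℝ E]
variable (ι : E →ₗ[ℝ] Matrix n n ℂ) (hι : ∀ a, (ι a)ᴴ = -ι a ∧ (ι a).trace = 0)
variable {L : Type*} {Lab : Type*} [MeasurableSpace Lab]
variable {δ δ₁ δ₂ δ₃ : Lab → ℝ} {g₁ g₂ g₃ : Lab → (L → Matrix.specialUnitaryGroup n ℂ) → L → E} {N : Lab → ℕ}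

/-- A labelled kick `(l, (U, p)) ↦ (U, p + g_l(U))` is jointly measurable (jointly measurable `g`). -/
private theorem measurable_uncurry_kick'
    {g : Lab → (L → Matrix.specialUnitaryGroup n ℂ) → L → E}
    (hg : Measurable fun q : Lab × (L → Matrix.specialUnitaryGroup n ℂ) => g q.1 q.2) :
    Measurable fun q : Lab × ((L → Matrix.specialUnitaryGroup n ℂ) × (L → E)) => kick (g q.1) q.2 := by
  have h1 : Measurable fun q : Lab × ((L → Matrix.specialUnitaryGroup n ℂ) × (L → E)) => g q.1 q.2.1 :=
    hg.comp (measurable_fst.prodMk (measurable_fst.comp measurable_snd))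
  exact (measurable_fst.comp measurable_snd).prodMk ((measurable_snd.comp measurable_snd).add h1)

/-- A labelled group drift `(l, (U, p)) ↦ ((exp(δ_l ι p_j) U_j)_j, p)` is jointly measurable (measurable `δ`). -/
private theorem measurable_uncurry_drift' (hδ : Measurable δ) :
    Measurable fun q : Lab × ((L → Matrix.specialUnitaryGroup n ℂ) × (L → E)) =>
      drift (mulDrift (sunExpDrift (L := L) ι hι (δ q.1))) q.2 := by
  have hexp : Measurable fun q : Lab × ((L → Matrix.specialUnitaryGroup n ℂ) × (L → E)) =>
      sunExpDrift (L := L) ι hι (δ q.1) q.2.2 := by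
    refine measurable_pi_lambda _ fun j => ?_
    have hsm : Measurable fun q : Lab × ((L → Matrix.specialUnitaryGroup n ℂ) × (L → E)) => δ q.1 • q.2.2 j :=
      (hδ.comp measurable_fst).smul ((measurable_pi_apply j).comp (measurable_snd.comp measurable_snd))
    exact (continuous_suExp ι hι).measurable.comp hsm
  exact (hexp.mul (measurable_fst.comp measurable_snd)).prodMk (measurable_snd.comp measurable_snd)

/-- **THE LABELLED OMF2 PROPOSAL IS JOINTLY MEASURABLE**: `(l, z) ↦ (flip ∘ (K(g₁ l) D_{δ l} K(g₂ l) D_{δ l} K(g₁ l))^{N l}) z`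
for measurable `δ`, `N` and jointly measurable `g₁`, `g₂`. -/
theorem measurable_uncurry_sunOmf2ProposalN (hδ : Measurable δ) (hN : Measurable N)
    (hg₁ : Measurable fun q : Lab × (L → Matrix.specialUnitaryGroup n ℂ) => g₁ q.1 q.2)
    (hg₂ : Measurable fun q : Lab × (L → Matrix.specialUnitaryGroup n ℂ) => g₂ q.1 q.2) :
    Measurable fun q : Lab × ((L → Matrix.specialUnitaryGroup n ℂ) × (L → E)) =>
      ((flip : Equiv.Perm ((L → Matrix.specialUnitaryGroup n ℂ) × (L → E))) * omf2Word (g₁ q.1) (mulDrift (sunExpDrift (L := L) ι hι (δ q.1))) (g₂ q.1) ^ N q.1) q.2 := by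
  have hword : Measurable fun q : Lab × ((L → Matrix.specialUnitaryGroup n ℂ) × (L → E)) =>
      omf2Word (g₁ q.1) (mulDrift (sunExpDrift (L := L) ι hι (δ q.1))) (g₂ q.1) q.2 := by
    have h := measurable_uncurry_palindromicWord (Z := ((L → Matrix.specialUnitaryGroup n ℂ) × (L → E)))
      [fun l => kick (g₁ l), fun l => drift (mulDrift (sunExpDrift (L := L) ι hι (δ l)))] (fun l => kick (g₂ l))
      (fun A hA => by
        simp only [List.mem_cons, List.not_mem_nil, or_false] at hA
        rcases hA with rfl | rfl
        · exact measurable_uncurry_kick' hg₁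
        · exact measurable_uncurry_drift' ι hι hδ)
      (measurable_uncurry_kick' hg₂)
    simpa only [omf2Word, List.map_cons, List.map_nil] using h
  have hit := measurable_uncurry_labelledPow (N := N)
    (f := fun l => ⇑(omf2Word (g₁ l) (mulDrift (sunExpDrift (L := L) ι hι (δ l))) (g₂ l))) hword hN
  have hcomp : (fun q : Lab × ((L → Matrix.specialUnitaryGroup n ℂ) × (L → E)) =>
      ((flip : Equiv.Perm ((L → Matrix.specialUnitaryGroup n ℂ) × (L → E))) * omf2Word (g₁ q.1) (mulDrift (sunExpDrift (L := L) ι hι (δ q.1))) (g₂ q.1) ^ N q.1) q.2) =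
      fun q => flip ((⇑(omf2Word (g₁ q.1) (mulDrift (sunExpDrift (L := L) ι hι (δ q.1))) (g₂ q.1)))^[N q.1] q.2) := by
    funext q; rw [Equiv.Perm.coe_mul, Function.comp_apply, Equiv.Perm.coe_pow]
  rw [hcomp]
  exact measurable_flip.comp hit

/-- **THE LABELLED OMF4 PROPOSAL (11 STAGES) IS JOINTLY MEASURABLE**: kicks `g₁ l, g₂ l, g₃ l` (outer, second, central),
drifts by `δ₁ l, δ₂ l, δ₃ l` (outer, second, central), `N l` steps, then the flip. -/
theorem measurable_uncurry_sunOmf4ProposalN (hδ₁ : Measurable δ₁) (hδ₂ : Measurable δ₂) (hδ₃ : Measurable δ₃)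
    (hN : Measurable N)
    (hg₁ : Measurable fun q : Lab × (L → Matrix.specialUnitaryGroup n ℂ) => g₁ q.1 q.2)
    (hg₂ : Measurable fun q : Lab × (L → Matrix.specialUnitaryGroup n ℂ) => g₂ q.1 q.2)
    (hg₃ : Measurable fun q : Lab × (L → Matrix.specialUnitaryGroup n ℂ) => g₃ q.1 q.2) :
    Measurable fun q : Lab × ((L → Matrix.specialUnitaryGroup n ℂ) × (L → E)) =>
      ((flip : Equiv.Perm ((L → Matrix.specialUnitaryGroup n ℂ) × (L → E))) * omf4Word (g₁ q.1) (mulDrift (sunExpDrift (L := L) ι hι (δ₁ q.1))) (g₂ q.1)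
        (mulDrift (sunExpDrift (L := L) ι hι (δ₂ q.1))) (g₃ q.1) (mulDrift (sunExpDrift (L := L) ι hι (δ₃ q.1))) ^ N q.1) q.2 := by
  have hword : Measurable fun q : Lab × ((L → Matrix.specialUnitaryGroup n ℂ) × (L → E)) =>
      omf4Word (g₁ q.1) (mulDrift (sunExpDrift (L := L) ι hι (δ₁ q.1))) (g₂ q.1)
        (mulDrift (sunExpDrift (L := L) ι hι (δ₂ q.1))) (g₃ q.1) (mulDrift (sunExpDrift (L := L) ι hι (δ₃ q.1))) q.2 := by
    have h := measurable_uncurry_palindromicWord (Z := ((L → Matrix.specialUnitaryGroup n ℂ) × (L → E)))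
      [fun l => kick (g₁ l), fun l => drift (mulDrift (sunExpDrift (L := L) ι hι (δ₁ l))), fun l => kick (g₂ l),
        fun l => drift (mulDrift (sunExpDrift (L := L) ι hι (δ₂ l))), fun l => kick (g₃ l)]
      (fun l => drift (mulDrift (sunExpDrift (L := L) ι hι (δ₃ l))))
      (fun A hA => by
        simp only [List.mem_cons, List.not_mem_nil, or_false] at hA
        rcases hA with rfl | rfl | rfl | rfl | rfl
        · exact measurable_uncurry_kick' hg₁
        · exact measurable_uncurry_drift' ι hι hδ₁
        · exact measurable_uncurry_kick' hg₂
        · exact measurable_uncurry_drift' ι hι hδ₂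
        · exact measurable_uncurry_kick' hg₃)
      (measurable_uncurry_drift' ι hι hδ₃)
    simpa only [omf4Word, List.map_cons, List.map_nil] using h
  have hit := measurable_uncurry_labelledPow (N := N)
    (f := fun l => ⇑(omf4Word (g₁ l) (mulDrift (sunExpDrift (L := L) ι hι (δ₁ l))) (g₂ l)
      (mulDrift (sunExpDrift (L := L) ι hι (δ₂ l))) (g₃ l) (mulDrift (sunExpDrift (L := L) ι hι (δ₃ l))))) hword hN
  have hcomp : (fun q : Lab × ((L → Matrix.specialUnitaryGroup n ℂ) × (L → E)) =>
      ((flip : Equiv.Perm ((L → Matrix.specialUnitaryGroup n ℂ) × (L → E))) * omf4Word (g₁ q.1) (mulDrift (sunExpDrift (L := L) ι hι (δ₁ q.1))) (g₂ q.1)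
        (mulDrift (sunExpDrift (L := L) ι hι (δ₂ q.1))) (g₃ q.1) (mulDrift (sunExpDrift (L := L) ι hι (δ₃ q.1))) ^ N q.1) q.2) =
      fun q => flip ((⇑(omf4Word (g₁ q.1) (mulDrift (sunExpDrift (L := L) ι hι (δ₁ q.1))) (g₂ q.1)
        (mulDrift (sunExpDrift (L := L) ι hι (δ₂ q.1))) (g₃ q.1) (mulDrift (sunExpDrift (L := L) ι hι (δ₃ q.1)))))^[N q.1] q.2) := by
    funext q; rw [Equiv.Perm.coe_mul, Function.comp_apply, Equiv.Perm.coe_pow]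
  rw [hcomp]
  exact measurable_flip.comp hit
end Measurable

/-! ## §2 The jittered OMF2 update for an arbitrary label law; exact for every law -/

section General
variable {n : Type*} [Fintype n] [DecidableEq n] {E : Type*} [NormedAddCommGroup E] [NormedSpace ℝ E]
  [MeasurableSpace E] [BorelSpace E] [FiniteDimensional ℝ E]
variable (ι : E →ₗ[ℝ] Matrix n n ℂ) (hι : ∀ a, (ι a)ᴴ = -ι a ∧ (ι a).trace = 0)
variable {L : Type*} [Fintype L] (μ : Measure E) (T : (L → E) → ℝ) {Lab : Type*} [MeasurableSpace Lab]
variable {δ : Lab → ℝ} (hδ : Measurable δ) {g₁ g₂ : Lab → (L → Matrix.specialUnitaryGroup n ℂ) → L → E}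
  (hg₁ : Measurable fun q : Lab × (L → Matrix.specialUnitaryGroup n ℂ) => g₁ q.1 q.2)
  (hg₂ : Measurable fun q : Lab × (L → Matrix.specialUnitaryGroup n ℂ) => g₂ q.1 q.2)
  (S : (L → Matrix.specialUnitaryGroup n ℂ) → ℝ) {N : Lab → ℕ} (hN : Measurable N) (η : Measure Lab)

/-- **THE JITTERED OMF2 HMC UPDATE ON `SU(N)^links` FOR AN ARBITRARY LABEL SPACE**: refresh the momentum
`p ∼ Z_T⁻¹e^{−T}·μ^{⊗links}` and an independent label `l ∼ η`, run `N_l` OMF2 steps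
`K(g₁ l) D_{δ l} K(g₂ l) D_{δ l} K(g₁ l)`, flip, Metropolis test on `S + T`, forget `(p, l)`. -/
def sunOmf2JitterHMCL : Kernel (L → Matrix.specialUnitaryGroup n ℂ) (L → Matrix.specialUnitaryGroup n ℂ) :=
  jitterHMC (fun l => ⇑((flip : Equiv.Perm ((L → Matrix.specialUnitaryGroup n ℂ) × (L → E))) *
      omf2Word (g₁ l) (mulDrift (sunExpDrift (L := L) ι hι (δ l))) (g₂ l) ^ N l))
    (measurable_jitterMap (measurable_uncurry_sunOmf2ProposalN ι hι hδ hN hg₁ hg₂)) S T η (sunMomentumLaw μ T)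

variable {hδ hg₁ hg₂ S hN η T}

/-- The jittered OMF2 update is Markov for every probability law `η` (and `Z_T < ∞`). -/
theorem isMarkovKernel_sunOmf2JitterHMCL [μ.IsAddHaarMeasure] [IsProbabilityMeasure η] (hT : Measurable T)
    (hZ : sunMomentumWeight (L := L) μ T univ ≠ ⊤) (hS : Measurable S) :
    IsMarkovKernel (sunOmf2JitterHMCL ι hι μ T hδ hg₁ hg₂ S hN η) := by
  haveI := isProbabilityMeasure_sunMomentumLaw (L := L) μ T hT hZ
  unfold sunOmf2JitterHMCL
  exact isMarkovKernel_jitterHMC _ _ η _ hS hT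

/-- **EXACT FOR EVERY LABEL LAW**: the jittered OMF2 update leaves `e^{−S}·Haar^{⊗links}` invariant, for every
probability law `η` on ANY measurable label space, every measurable `δ`, `N`, jointly measurable `g₁`, `g₂`, every
measurable `S`, every measurable `T` with `Z_T < ∞` (time reversal of the palindromic word, Liouville stage by stage,
`jitterHMC_exact`). -/
theorem sunOmf2JitterHMCL_invariant [μ.IsAddHaarMeasure] [IsProbabilityMeasure η] (hT : Measurable T)
    (hZ : sunMomentumWeight (L := L) μ T univ ≠ ⊤) (hS : Measurable S) :
    Invariant (sunOmf2JitterHMCL ι hι μ T hδ hg₁ hg₂ S hN η)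
      ((Measure.pi fun _ : L => haarProbability (Matrix.specialUnitaryGroup n ℂ)).withDensity
        fun u => ENNReal.ofReal (Real.exp (-S u))) := by
  haveI := isNegInvariant_pi (L := L) μ
  refine jitterHMC_exact (vol := Measure.pi fun _ : L => haarProbability (Matrix.specialUnitaryGroup n ℂ))
    (volP := Measure.pi fun _ : L => μ) η hS hT (fun l => ?_) (fun l => ?_) (sunMomentumWeight_univ_ne_zero μ T hT) hZ
  · exact (palindromicWord_pow_isFlipReversible flip_mul_flip (kick_isFlipReversible (g₂ l))
      (omf2_stages_isFlipReversible (mulDrift_reversal (sunExpDrift_neg ι hι (δ l)))) (N l)).involutive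
  · rw [Equiv.Perm.coe_mul]
    exact measurePreserving_flip.comp (measurePreserving_perm_pow
      (measurePreserving_palindromicWord (measurePreserving_kick (hg₂.comp measurable_prodMk_left))
        (omf2_stages_measurePreserving (measurable_mulDrift (measurable_sunExpDrift ι hι (δ l)))
          (measurePreserving_mulDrift (sunExpDrift ι hι (δ l))) (hg₁.comp measurable_prodMk_left))) (N l))
end General

/-! ## §3 The jittered OMF4 update for an arbitrary label law; exact for every law -/

section General4
variable {n : Type*} [Fintype n] [DecidableEq n] {E : Type*} [NormedAddCommGroup E] [NormedSpace ℝ E]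
  [MeasurableSpace E] [BorelSpace E] [FiniteDimensional ℝ E]
variable (ι : E →ₗ[ℝ] Matrix n n ℂ) (hι : ∀ a, (ι a)ᴴ = -ι a ∧ (ι a).trace = 0)
variable {L : Type*} [Fintype L] (μ : Measure E) (T : (L → E) → ℝ) {Lab : Type*} [MeasurableSpace Lab]
variable {δ₁ δ₂ δ₃ : Lab → ℝ} (hδ₁ : Measurable δ₁) (hδ₂ : Measurable δ₂) (hδ₃ : Measurable δ₃)
  {g₁ g₂ g₃ : Lab → (L → Matrix.specialUnitaryGroup n ℂ) → L → E}
  (hg₁ : Measurable fun q : Lab × (L → Matrix.specialUnitaryGroup n ℂ) => g₁ q.1 q.2)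
  (hg₂ : Measurable fun q : Lab × (L → Matrix.specialUnitaryGroup n ℂ) => g₂ q.1 q.2)
  (hg₃ : Measurable fun q : Lab × (L → Matrix.specialUnitaryGroup n ℂ) => g₃ q.1 q.2)
  (S : (L → Matrix.specialUnitaryGroup n ℂ) → ℝ) {N : Lab → ℕ} (hN : Measurable N) (η : Measure Lab)

/-- **THE JITTERED OMF4 HMC UPDATE ON `SU(N)^links` FOR AN ARBITRARY LABEL SPACE** (11 stages per step). -/
def sunOmf4JitterHMCL : Kernel (L → Matrix.specialUnitaryGroup n ℂ) (L → Matrix.specialUnitaryGroup n ℂ) :=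
  jitterHMC (fun l => ⇑((flip : Equiv.Perm ((L → Matrix.specialUnitaryGroup n ℂ) × (L → E))) *
      omf4Word (g₁ l) (mulDrift (sunExpDrift (L := L) ι hι (δ₁ l))) (g₂ l) (mulDrift (sunExpDrift (L := L) ι hι (δ₂ l)))
        (g₃ l) (mulDrift (sunExpDrift (L := L) ι hι (δ₃ l))) ^ N l))
    (measurable_jitterMap (measurable_uncurry_sunOmf4ProposalN ι hι hδ₁ hδ₂ hδ₃ hN hg₁ hg₂ hg₃)) S T η (sunMomentumLaw μ T)

variable {hδ₁ hδ₂ hδ₃ hg₁ hg₂ hg₃ S hN η T}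

/-- The jittered OMF4 update is Markov for every probability law `η` (and `Z_T < ∞`). -/
theorem isMarkovKernel_sunOmf4JitterHMCL [μ.IsAddHaarMeasure] [IsProbabilityMeasure η] (hT : Measurable T)
    (hZ : sunMomentumWeight (L := L) μ T univ ≠ ⊤) (hS : Measurable S) :
    IsMarkovKernel (sunOmf4JitterHMCL ι hι μ T hδ₁ hδ₂ hδ₃ hg₁ hg₂ hg₃ S hN η) := by
  haveI := isProbabilityMeasure_sunMomentumLaw (L := L) μ T hT hZ
  unfold sunOmf4JitterHMCL
  exact isMarkovKernel_jitterHMC _ _ η _ hS hT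

/-- **EXACT FOR EVERY LABEL LAW** (OMF4): `e^{−S}·Haar^{⊗links}` is invariant, for every probability law `η` on ANY
measurable label space, all measurable drift/step assignments and kick fields, measurable `S`, `T` with `Z_T < ∞`. -/
theorem sunOmf4JitterHMCL_invariant [μ.IsAddHaarMeasure] [IsProbabilityMeasure η] (hT : Measurable T)
    (hZ : sunMomentumWeight (L := L) μ T univ ≠ ⊤) (hS : Measurable S) :
    Invariant (sunOmf4JitterHMCL ι hι μ T hδ₁ hδ₂ hδ₃ hg₁ hg₂ hg₃ S hN η)
      ((Measure.pi fun _ : L => haarProbability (Matrix.specialUnitaryGroup n ℂ)).withDensity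
        fun u => ENNReal.ofReal (Real.exp (-S u))) := by
  haveI := isNegInvariant_pi (L := L) μ
  refine jitterHMC_exact (vol := Measure.pi fun _ : L => haarProbability (Matrix.specialUnitaryGroup n ℂ))
    (volP := Measure.pi fun _ : L => μ) η hS hT (fun l => ?_) (fun l => ?_) (sunMomentumWeight_univ_ne_zero μ T hT) hZ
  · exact (palindromicWord_pow_isFlipReversible flip_mul_flip
      (drift_isFlipReversible (mulDrift_reversal (sunExpDrift_neg ι hι (δ₃ l))))
      (omf4_stages_isFlipReversible (mulDrift_reversal (sunExpDrift_neg ι hι (δ₁ l)))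
        (mulDrift_reversal (sunExpDrift_neg ι hι (δ₂ l)))) (N l)).involutive
  · rw [Equiv.Perm.coe_mul]
    exact measurePreserving_flip.comp (measurePreserving_perm_pow
      (measurePreserving_palindromicWord
        (measurePreserving_drift (measurable_mulDrift (measurable_sunExpDrift ι hι (δ₃ l)))
          (measurePreserving_mulDrift (sunExpDrift ι hι (δ₃ l))))
        (omf4_stages_measurePreserving (measurable_mulDrift (measurable_sunExpDrift ι hι (δ₁ l)))
          (measurePreserving_mulDrift (sunExpDrift ι hι (δ₁ l)))
          (measurable_mulDrift (measurable_sunExpDrift ι hι (δ₂ l))) (measurePreserving_mulDrift (sunExpDrift ι hι (δ₂ l)))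
          (hg₁.comp measurable_prodMk_left) (hg₂.comp measurable_prodMk_left) (hg₃.comp measurable_prodMk_left))) (N l))
end General4

/-! ## §4 The engine's `'omf2'` / `'omf4'` HMC as run, with a general law of the trajectory length -/

section Wilson
variable (N d L : ℕ) [NeZero L]

/-- A labelled scalar kick `(τ', U) ↦ (c(τ'))·F(U)` is jointly measurable in the length and the configuration
(measurable `c`, measurable `F`). -/
theorem measurable_uncurry_smulKick_sun {Lk : Type*} {F : (Lk → Matrix.specialUnitaryGroup (Fin N) ℂ) → Lk → SUNCoords N}
    (hF : Measurable F) {c : ℝ → ℝ} (hc : Measurable c) :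
    Measurable fun q : ℝ × (Lk → Matrix.specialUnitaryGroup (Fin N) ℂ) => (c q.1) • F q.2 := by
  haveI : OpensMeasurableSpace (ℝ × SUNCoords N) := Prod.opensMeasurableSpace
  have hs : Measurable fun p : ℝ × SUNCoords N => p.1 • p.2 := continuous_smul.measurable
  exact measurable_pi_lambda _ fun l => hs.comp
    ((hc.comp measurable_fst).prodMk ((measurable_pi_apply l).comp (hF.comp measurable_snd)))

/-- **THE ENGINE'S JITTERED OMF2 HMC ON `SU(N)` AS RUN, FOR A GENERAL LAW `η` OF THE TRAJECTORY LENGTH**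
(`hmc.HMC(f, β, 'omf2').trajectory(τ, nstep, tau_jitter)`, torus `(ℤ/L)^d`): refresh the momenta and a length
`τ' ∼ η`; `nstep` OMF2 steps with `ε = τ'/nstep`: kicks `−(λε)·F(U)`, `−((1−2λ)ε)·F(U)`, `−(λε)·F(U)`,
`F(U) = sunWilsonForceLaw N β (coeConfig U)`, separated by two drifts by `ε/2`; Metropolis test on `(β/N)·S_W + T`. -/
def wilsonOmf2JitterHMCL (β lam : ℝ) (nstep : ℕ) (η : Measure ℝ) :
    Kernel (GaugeConfig d L (Matrix.specialUnitaryGroup (Fin N) ℂ)) (GaugeConfig d L (Matrix.specialUnitaryGroup (Fin N) ℂ)) :=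
  sunOmf2JitterHMCL (sunCoordι N) (sunCoordι_skew N) (Measure.addHaar : Measure (SUNCoords N)) (sunKinetic N)
    (δ := fun τ' : ℝ => τ' / nstep / 2) ((measurable_id.div_const _).div_const _)
    (g₁ := fun τ' U => (-(lam * (τ' / nstep))) • sunWilsonForceLaw N β (coeConfig U))
    (g₂ := fun τ' U => (-((1 - 2 * lam) * (τ' / nstep))) • sunWilsonForceLaw N β (coeConfig U))
    (measurable_uncurry_smulKick_sun N (measurable_sunWilsonForceLaw_coeConfig N (d := d) (L := L) β)
      ((measurable_const.mul (measurable_id.div_const _)).neg))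
    (measurable_uncurry_smulKick_sun N (measurable_sunWilsonForceLaw_coeConfig N (d := d) (L := L) β)
      ((measurable_const.mul (measurable_id.div_const _)).neg))
    (fun U => β / N * wilsonAction (fundamentalRep (Fin N)) U) (N := fun _ => nstep) measurable_const η

/-- **THE ENGINE'S JITTERED OMF4 HMC ON `SU(N)` AS RUN, FOR A GENERAL LAW `η` OF THE TRAJECTORY LENGTH**
(`hmc.HMC(f, β, 'omf4').trajectory(τ, nstep, tau_jitter)`): `ε = τ'/nstep`; per step kicks `−(ϑε)·F`, `−(λε)·F`,
`−((½−λ−ϑ)ε)·F` (outer, second, central) and drifts by `ρε`, `θε`, `(1−2(θ+ρ))ε`; the code's constants `OMF4_RHO,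
OMF4_THETA, OMF4_VARTHETA, OMF4_LAMBDA` enter as the free reals `rho, theta, vth, lam`. -/
def wilsonOmf4JitterHMCL (β rho theta vth lam : ℝ) (nstep : ℕ) (η : Measure ℝ) :
    Kernel (GaugeConfig d L (Matrix.specialUnitaryGroup (Fin N) ℂ)) (GaugeConfig d L (Matrix.specialUnitaryGroup (Fin N) ℂ)) :=
  sunOmf4JitterHMCL (sunCoordι N) (sunCoordι_skew N) (Measure.addHaar : Measure (SUNCoords N)) (sunKinetic N)
    (δ₁ := fun τ' : ℝ => rho * (τ' / nstep)) (δ₂ := fun τ' : ℝ => theta * (τ' / nstep))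
    (δ₃ := fun τ' : ℝ => (1 - 2 * (theta + rho)) * (τ' / nstep))
    (measurable_const.mul (measurable_id.div_const _)) (measurable_const.mul (measurable_id.div_const _))
    (measurable_const.mul (measurable_id.div_const _))
    (g₁ := fun τ' U => (-(vth * (τ' / nstep))) • sunWilsonForceLaw N β (coeConfig U))
    (g₂ := fun τ' U => (-(lam * (τ' / nstep))) • sunWilsonForceLaw N β (coeConfig U))
    (g₃ := fun τ' U => (-((1 / 2 - (lam + vth)) * (τ' / nstep))) • sunWilsonForceLaw N β (coeConfig U))
    (measurable_uncurry_smulKick_sun N (measurable_sunWilsonForceLaw_coeConfig N (d := d) (L := L) β)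
      ((measurable_const.mul (measurable_id.div_const _)).neg))
    (measurable_uncurry_smulKick_sun N (measurable_sunWilsonForceLaw_coeConfig N (d := d) (L := L) β)
      ((measurable_const.mul (measurable_id.div_const _)).neg))
    (measurable_uncurry_smulKick_sun N (measurable_sunWilsonForceLaw_coeConfig N (d := d) (L := L) β)
      ((measurable_const.mul (measurable_id.div_const _)).neg))
    (fun U => β / N * wilsonAction (fundamentalRep (Fin N)) U) (N := fun _ => nstep) measurable_const η

variable {N d L}

/-- The engine's jittered OMF2 update is Markov (every probability law `η` of the length). -/
instance isMarkovKernel_wilsonOmf2JitterHMCL [NeZero N] (β lam : ℝ) (nstep : ℕ) (η : Measure ℝ)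
    [IsProbabilityMeasure η] : IsMarkovKernel (wilsonOmf2JitterHMCL N d L β lam nstep η) :=
  isMarkovKernel_sunOmf2JitterHMCL _ _ _ (measurable_sunKinetic N) (sunMomentumWeight_sunKinetic_ne_top N Measure.addHaar)
    (measurable_engineWilsonAction N β)

/-- **THE ENGINE'S `'omf2'` HMC IS EXACT FOR EVERY `λ`, EVERY `nstep` AND EVERY LAW OF THE TRAJECTORY LENGTH**
(no jitter: `η = δ_τ`; `tau_jitter = j`: the uniform law of `UniformJitterLaw.lean`; anything Borel):
`wilsonMeasure (β/N)` is invariant. -/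
theorem wilsonOmf2JitterHMCL_invariant [NeZero N] (β lam : ℝ) (nstep : ℕ) (η : Measure ℝ) [IsProbabilityMeasure η] :
    Invariant (wilsonOmf2JitterHMCL N d L β lam nstep η) (wilsonMeasure (d := d) (L := L) (fundamentalRep (Fin N)) (β / N)) := by
  rw [← gibbsProbability_smul_wilsonAction_eq N (d := d) (L := L) (fundamentalRep (Fin N)) (β / N)]
  exact invariant_gibbsProbability (sunOmf2JitterHMCL_invariant (sunCoordι N) (sunCoordι_skew N) Measure.addHaar
    (measurable_sunKinetic N) (sunMomentumWeight_sunKinetic_ne_top N Measure.addHaar) (measurable_engineWilsonAction N β))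

/-- The engine's jittered OMF4 update is Markov (every probability law `η` of the length). -/
instance isMarkovKernel_wilsonOmf4JitterHMCL [NeZero N] (β rho theta vth lam : ℝ) (nstep : ℕ) (η : Measure ℝ)
    [IsProbabilityMeasure η] : IsMarkovKernel (wilsonOmf4JitterHMCL N d L β rho theta vth lam nstep η) :=
  isMarkovKernel_sunOmf4JitterHMCL _ _ _ (measurable_sunKinetic N) (sunMomentumWeight_sunKinetic_ne_top N Measure.addHaar)
    (measurable_engineWilsonAction N β)

/-- **THE ENGINE'S `'omf4'` HMC IS EXACT FOR EVERY COEFFICIENT CHOICE, EVERY `nstep` AND EVERY LAW OF THE TRAJECTORY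
LENGTH**: `wilsonMeasure (β/N)` is invariant. -/
theorem wilsonOmf4JitterHMCL_invariant [NeZero N] (β rho theta vth lam : ℝ) (nstep : ℕ) (η : Measure ℝ)
    [IsProbabilityMeasure η] :
    Invariant (wilsonOmf4JitterHMCL N d L β rho theta vth lam nstep η)
      (wilsonMeasure (d := d) (L := L) (fundamentalRep (Fin N)) (β / N)) := by
  rw [← gibbsProbability_smul_wilsonAction_eq N (d := d) (L := L) (fundamentalRep (Fin N)) (β / N)]
  exact invariant_gibbsProbability (sunOmf4JitterHMCL_invariant (sunCoordι N) (sunCoordι_skew N) Measure.addHaar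
    (measurable_sunKinetic N) (sunMomentumWeight_sunKinetic_ne_top N Measure.addHaar) (measurable_engineWilsonAction N β))
end Wilson

end Summit.Ventures.LatticeQCDFlow.Exactness
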